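import Summits.HodgeConjecture.HodgeConjecture.Theorems.Ring2WeilCoverageWeilGramLevel36Principal
import Summits.HodgeConjecture.HodgeConjecture.Theorems.Ring2WeilCoverageWeilGramSign
import HarnessLib

/-!
# Weil-type family coverage — THE COMPONENTS OF THE WEIL-TYPE `ℤ[ζ₃₆]`-SIXFOLDS, III: `K_d = ℚ(√−3)` (`s₃ = 1 + 2ζ¹²`):
# principal-type Gram determinant `+1728 = 3·24²` — the WRONG sign: NO principal-type `E_ζ′` is `Φ`-positive on a
# `ℚ(√−3)`-Weil-type CM type (the census NO row `(36, ℚ(√−3))`, from van Geemen's sign)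

research route conditional on HC_CM; not a corollary; Q11.4-sentence-2 already refuted in dim ≥ 3.

Ring 2, WEIL-TYPE FAMILY-COVERAGE CENSUS (`HOME/WEIL-FAMILY-COVERAGE.md` `## b01`, blocks b01.34 (the NO row
`(ℚ(ζ₃₆), √−3)`: `not_exists_principal_thirtySix`), b01.41 (C)), part 111 of the `Ring2WeilCoverage*` series; continues
parts 109/110.

* §0 `s₃ = 1 + 2ζ¹²` is skew with `s₃² = −3`.
* §1 `(E_ξ, s₃)`: eleven traces, **`det a = 1728 > 0`**; §2 invariance over the principal type (THEOREM L (i) at `36`);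
  §3 **NO principal-type `ζ′` is `Φ`-positive on a CM type of `s₃`-signature `(3,3)`** (`(−1)³·1728 < 0`, part 92) —
  `not_exists_principal_thirtySix` RE-DERIVED from the sign of `det H`.  Parts 112–114: types `𝔮₃`, `𝔮₂` (→ R1),
  `(1 + 2√3)`.

HONEST FRAMING as parts 109/110; `HC_CM` is used nowhere.  No `def`, no named fact, no `sorry`.  Certificates from
`work/py/gen6.py` + `lev36.py`, re-verified by `linear_combination`.

References: [cite: vanGeemen1994HodgeAV, Lemma 5.2 (2)–(4), 5.4 and (5.4.1)]; [cite: Shimura1998, §14.3 Prop. 4–5,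
pp. 103–104]; census b01.34, b01.41 (C) (seat-derived).
-/

noncomputable section

open Polynomial NumberField Module
open scoped nonZeroDivisors

namespace Summit.HodgeConjecture.Ring2WeilCoverage.WeilGramLevel36SqrtNegThree

open Literature.AlgebraicGeometry.VanGeemen1994 (weilField weilNormResidueGroup)
open Literature.AlgebraicGeometry.Motives (CMType normUnitsSubgroup)
open Literature.NumberTheory.ComplexMultiplication
open Summit.HodgeConjecture.Ring2WeilCoverage.TraceGramDeterminant (trace_aeval_zeta_mul_inv)
open Summit.HodgeConjecture.Ring2WeilCoverage.WeilGramCMPoint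
open Summit.HodgeConjecture.Ring2WeilCoverage.RealUnitNormHalfSystems (complexConj_eq_inv)
open Summit.HodgeConjecture.Ring2WeilCoverage.CyclotomicPrincipalObstruction (complexConj_xi)
open Summit.HodgeConjecture.Ring2WeilCoverage.CyclotomicDifferent (isOfType_one_xi_top xi_ne_zero)
open Summit.HodgeConjecture.HodgeConjecture.Ring2.WeilCoverage (mk_neg_eq_split_of_odd mk_neg_ne_split_of_odd
  mem_normUnitsSubgroup_of_sq_add_mul_sq)
open Summit.HodgeConjecture.HodgeConjecture.Ring2.Hypotheses (splitDiscriminantClass)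
open Summit.HodgeConjecture.Ring2WeilCoverage.WeilGramLevel36
open Summit.HodgeConjecture.Ring2WeilCoverage.WeilGramLevel36Principal
open Summit.HodgeConjecture.Ring2WeilCoverage.WeilGramSign (not_pos_of_neg_one_pow_mul_det_nonpos)
open Summit.HodgeConjecture.Ring2WeilCoverage.CyclotomicUnconditional (norm_realUnits_pos_thirtySix)
variable {K : Type} [Field K] [NumberField K] {ζ : K}

/-! ### §0 `s₃ = 1 + 2ζ¹²` -/

omit [NumberField K] in
/-- **`(1 + 2ζ¹²)² = −3`**: `s = √−3 = 1 + 2ζ¹²` generates `K_d = ℚ(√−3) ⊂ ℚ(ζ_36)`. [folklore] -/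
theorem sq_sqrtNegThree (hζ : IsPrimitiveRoot ζ 36) : (1 + 2 * ζ ^ 12) ^ 2 = -3 := by
  linear_combination (4 + 4 * ζ^6 + 4 * ζ^12) * cyc_thirtySix hζ

/-- **`s = √−3 = 1 + 2ζ¹²` is skew** (`s^ρ = −s`). [folklore] -/
theorem complexConj_sqrtNegThree [IsCMField K] (hζ : IsPrimitiveRoot ζ 36) :
    IsCMField.complexConj K (1 + 2 * ζ ^ 12) = -(1 + 2 * ζ ^ 12) := by
  simp only [map_add, map_mul, map_pow, map_one, map_ofNat, complexConj_eq_inv hζ]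
  rw [inv_pow_eq_pow hζ (show 12 + 24 = 36 by norm_num)]
  linear_combination (2 + 2 * ζ^6 + 2 * ζ^12) * cyc_thirtySix hζ

/-! ### §1 The principal-type form `(E_ξ, s₃)`: `det a = 1728` -/

/-- `Tr(ζ′sθ^0) = 2` for `ζ′ = ξ = ζ⁵/Φ₃₆′(ζ)`, `s = √−3 = 1 + 2ζ¹²`, `θ = ζ + ζ⁻¹` (Euler evaluation). research route conditional on HC_CM; not a corollary; Q11.4-sentence-2 already refuted in dim ≥ 3. [folklore] -/
theorem trace_xi_sqrtNegThree_zero [IsCyclotomicExtension {36} ℚ K] (hζ : IsPrimitiveRoot ζ 36) :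
    Algebra.trace ℚ K ((ζ ^ 5 * (aeval ζ (derivative (cyclotomic 36 ℚ)))⁻¹) * (1 + 2 * ζ ^ 12)) = 2 := by
  have hΦ := cyc_thirtySix hζ
  rw [trace_of_key₀ hζ (C (0 : ℚ) + C (0 : ℚ) * X + C (0 : ℚ) * X ^ 2 + C (0 : ℚ) * X ^ 3 + C (0 : ℚ) * X ^ 4 + C (-1 : ℚ) * X ^ 5 +
      C (0 : ℚ) * X ^ 6 + C (0 : ℚ) * X ^ 7 + C (0 : ℚ) * X ^ 8 + C (0 : ℚ) * X ^ 9 + C (0 : ℚ) * X ^ 10 +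
      C (2 : ℚ) * X ^ 11) (by compute_degree) (by
    simp only [map_add, map_mul, map_pow, aeval_C, aeval_X, eq_ratCast]
    push_cast
    linear_combination ((aeval ζ (derivative (cyclotomic 36 ℚ)))⁻¹ * (2 * ζ^5)) * hΦ)]
  norm_num [coeff_X_pow, coeff_X, coeff_C, coeff_one]

/-- `Tr(ζ′sθ^1) = 0` for `ζ′ = ξ = ζ⁵/Φ₃₆′(ζ)`, `s = √−3 = 1 + 2ζ¹²`, `θ = ζ + ζ⁻¹` (Euler evaluation). research route conditional on HC_CM; not a corollary; Q11.4-sentence-2 already refuted in dim ≥ 3. [folklore] -/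
theorem trace_xi_sqrtNegThree_one [IsCyclotomicExtension {36} ℚ K] (hζ : IsPrimitiveRoot ζ 36) :
    Algebra.trace ℚ K ((ζ ^ 5 * (aeval ζ (derivative (cyclotomic 36 ℚ)))⁻¹) * (1 + 2 * ζ ^ 12) * (ζ + ζ⁻¹)) = 0 := by
  have hΦ := cyc_thirtySix hζ
  rw [trace_of_key₁ hζ (C (-2 : ℚ) + C (0 : ℚ) * X + C (0 : ℚ) * X ^ 2 + C (0 : ℚ) * X ^ 3 + C (-1 : ℚ) * X ^ 4 +
      C (0 : ℚ) * X ^ 5 + C (1 : ℚ) * X ^ 6 + C (0 : ℚ) * X ^ 7 + C (0 : ℚ) * X ^ 8 + C (0 : ℚ) * X ^ 9 +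
      C (2 : ℚ) * X ^ 10 + C (0 : ℚ) * X ^ 11) (by compute_degree) (by
    simp only [map_add, map_mul, map_pow, aeval_C, aeval_X, eq_ratCast]
    push_cast
    linear_combination ((aeval ζ (derivative (cyclotomic 36 ℚ)))⁻¹ * (2 * ζ + 2 * ζ^5 + 2 * ζ^7)) * hΦ)]
  norm_num [coeff_X_pow, coeff_X, coeff_C, coeff_one]

/-- `Tr(ζ′sθ^2) = 4` for `ζ′ = ξ = ζ⁵/Φ₃₆′(ζ)`, `s = √−3 = 1 + 2ζ¹²`, `θ = ζ + ζ⁻¹` (Euler evaluation). research route conditional on HC_CM; not a corollary; Q11.4-sentence-2 already refuted in dim ≥ 3. [folklore] -/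
theorem trace_xi_sqrtNegThree_two [IsCyclotomicExtension {36} ℚ K] (hζ : IsPrimitiveRoot ζ 36) :
    Algebra.trace ℚ K ((ζ ^ 5 * (aeval ζ (derivative (cyclotomic 36 ℚ)))⁻¹) * (1 + 2 * ζ ^ 12) * (ζ + ζ⁻¹) ^ 2) = 4 := by
  have hΦ := cyc_thirtySix hζ
  rw [trace_of_key hζ (C (0 : ℚ) + C (-2 : ℚ) * X + C (0 : ℚ) * X ^ 2 + C (-1 : ℚ) * X ^ 3 + C (0 : ℚ) * X ^ 4 +
      C (-2 : ℚ) * X ^ 5 + C (0 : ℚ) * X ^ 6 + C (1 : ℚ) * X ^ 7 + C (0 : ℚ) * X ^ 8 + C (2 : ℚ) * X ^ 9 +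
      C (0 : ℚ) * X ^ 10 + C (4 : ℚ) * X ^ 11) (by compute_degree) (by
    simp only [map_add, map_mul, map_pow, aeval_C, aeval_X, eq_ratCast]
    push_cast
    linear_combination ((aeval ζ (derivative (cyclotomic 36 ℚ)))⁻¹ * (2 * ζ^3 + 2 * ζ^5 + 4 * ζ^7 + 2 * ζ^9)) * hΦ)]
  norm_num [coeff_X_pow, coeff_X, coeff_C, coeff_one]

/-- `Tr(ζ′sθ^3) = 0` for `ζ′ = ξ = ζ⁵/Φ₃₆′(ζ)`, `s = √−3 = 1 + 2ζ¹²`, `θ = ζ + ζ⁻¹` (Euler evaluation). research route conditional on HC_CM; not a corollary; Q11.4-sentence-2 already refuted in dim ≥ 3. [folklore] -/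
theorem trace_xi_sqrtNegThree_three [IsCyclotomicExtension {36} ℚ K] (hζ : IsPrimitiveRoot ζ 36) :
    Algebra.trace ℚ K ((ζ ^ 5 * (aeval ζ (derivative (cyclotomic 36 ℚ)))⁻¹) * (1 + 2 * ζ ^ 12) * (ζ + ζ⁻¹) ^ 3) = 0 := by
  have hΦ := cyc_thirtySix hζ
  rw [trace_of_key hζ (C (-6 : ℚ) + C (0 : ℚ) * X + C (-3 : ℚ) * X ^ 2 + C (0 : ℚ) * X ^ 3 + C (-3 : ℚ) * X ^ 4 +
      C (0 : ℚ) * X ^ 5 + C (3 : ℚ) * X ^ 6 + C (0 : ℚ) * X ^ 7 + C (3 : ℚ) * X ^ 8 + C (0 : ℚ) * X ^ 9 +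
      C (6 : ℚ) * X ^ 10 + C (0 : ℚ) * X ^ 11) (by compute_degree) (by
    simp only [map_add, map_mul, map_pow, aeval_C, aeval_X, eq_ratCast]
    push_cast
    linear_combination ((aeval ζ (derivative (cyclotomic 36 ℚ)))⁻¹ * (6 * ζ^3 + 4 * ζ^5 + 6 * ζ^7 + 6 * ζ^9 + 2 * ζ^11)) * hΦ)]
  norm_num [coeff_X_pow, coeff_X, coeff_C, coeff_one]

/-- `Tr(ζ′sθ^4) = 12` for `ζ′ = ξ = ζ⁵/Φ₃₆′(ζ)`, `s = √−3 = 1 + 2ζ¹²`, `θ = ζ + ζ⁻¹` (Euler evaluation). research route conditional on HC_CM; not a corollary; Q11.4-sentence-2 already refuted in dim ≥ 3. [folklore] -/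
theorem trace_xi_sqrtNegThree_four [IsCyclotomicExtension {36} ℚ K] (hζ : IsPrimitiveRoot ζ 36) :
    Algebra.trace ℚ K ((ζ ^ 5 * (aeval ζ (derivative (cyclotomic 36 ℚ)))⁻¹) * (1 + 2 * ζ ^ 12) * (ζ + ζ⁻¹) ^ 4) = 12 := by
  have hΦ := cyc_thirtySix hζ
  rw [trace_of_key hζ (C (0 : ℚ) + C (-9 : ℚ) * X + C (0 : ℚ) * X ^ 2 + C (-6 : ℚ) * X ^ 3 + C (0 : ℚ) * X ^ 4 +
      C (-6 : ℚ) * X ^ 5 + C (0 : ℚ) * X ^ 6 + C (6 : ℚ) * X ^ 7 + C (0 : ℚ) * X ^ 8 + C (9 : ℚ) * X ^ 9 +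
      C (0 : ℚ) * X ^ 10 + C (12 : ℚ) * X ^ 11) (by compute_degree) (by
    simp only [map_add, map_mul, map_pow, aeval_C, aeval_X, eq_ratCast]
    push_cast
    linear_combination ((aeval ζ (derivative (cyclotomic 36 ℚ)))⁻¹ * (10 * ζ^5 + 10 * ζ^7 + 12 * ζ^9 + 8 * ζ^11 + 2 * ζ^13)) * hΦ)]
  norm_num [coeff_X_pow, coeff_X, coeff_C, coeff_one]

/-- `Tr(ζ′sθ^5) = 0` for `ζ′ = ξ = ζ⁵/Φ₃₆′(ζ)`, `s = √−3 = 1 + 2ζ¹²`, `θ = ζ + ζ⁻¹` (Euler evaluation). research route conditional on HC_CM; not a corollary; Q11.4-sentence-2 already refuted in dim ≥ 3. [folklore] -/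
theorem trace_xi_sqrtNegThree_five [IsCyclotomicExtension {36} ℚ K] (hζ : IsPrimitiveRoot ζ 36) :
    Algebra.trace ℚ K ((ζ ^ 5 * (aeval ζ (derivative (cyclotomic 36 ℚ)))⁻¹) * (1 + 2 * ζ ^ 12) * (ζ + ζ⁻¹) ^ 5) = 0 := by
  have hΦ := cyc_thirtySix hζ
  rw [trace_of_key hζ (C (-21 : ℚ) + C (0 : ℚ) * X + C (-15 : ℚ) * X ^ 2 + C (0 : ℚ) * X ^ 3 + C (-12 : ℚ) * X ^ 4 +
      C (0 : ℚ) * X ^ 5 + C (12 : ℚ) * X ^ 6 + C (0 : ℚ) * X ^ 7 + C (15 : ℚ) * X ^ 8 + C (0 : ℚ) * X ^ 9 +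
      C (21 : ℚ) * X ^ 10 + C (0 : ℚ) * X ^ 11) (by compute_degree) (by
    simp only [map_add, map_mul, map_pow, aeval_C, aeval_X, eq_ratCast]
    push_cast
    linear_combination ((aeval ζ (derivative (cyclotomic 36 ℚ)))⁻¹ * (22 * ζ^5 + 20 * ζ^7 + 22 * ζ^9 + 20 * ζ^11 + 10 * ζ^13 + 2 * ζ^15)) * hΦ)]
  norm_num [coeff_X_pow, coeff_X, coeff_C, coeff_one]

/-- `Tr(ζ′sθ^6) = 42` for `ζ′ = ξ = ζ⁵/Φ₃₆′(ζ)`, `s = √−3 = 1 + 2ζ¹²`, `θ = ζ + ζ⁻¹` (Euler evaluation). research route conditional on HC_CM; not a corollary; Q11.4-sentence-2 already refuted in dim ≥ 3. [folklore] -/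
theorem trace_xi_sqrtNegThree_six [IsCyclotomicExtension {36} ℚ K] (hζ : IsPrimitiveRoot ζ 36) :
    Algebra.trace ℚ K ((ζ ^ 5 * (aeval ζ (derivative (cyclotomic 36 ℚ)))⁻¹) * (1 + 2 * ζ ^ 12) * (ζ + ζ⁻¹) ^ 6) = 42 := by
  have hΦ := cyc_thirtySix hζ
  rw [trace_of_key hζ (C (0 : ℚ) + C (-36 : ℚ) * X + C (0 : ℚ) * X ^ 2 + C (-27 : ℚ) * X ^ 3 + C (0 : ℚ) * X ^ 4 +
      C (-21 : ℚ) * X ^ 5 + C (0 : ℚ) * X ^ 6 + C (27 : ℚ) * X ^ 7 + C (0 : ℚ) * X ^ 8 + C (36 : ℚ) * X ^ 9 +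
      C (0 : ℚ) * X ^ 10 + C (42 : ℚ) * X ^ 11) (by compute_degree) (by
    simp only [map_add, map_mul, map_pow, aeval_C, aeval_X, eq_ratCast]
    push_cast
    linear_combination ((aeval ζ (derivative (cyclotomic 36 ℚ)))⁻¹ * (ζ^5 + 42 * ζ^7 + 42 * ζ^9 + 42 * ζ^11 + 30 * ζ^13 + 12 * ζ^15 + 2 * ζ^17)) * hΦ)]
  norm_num [coeff_X_pow, coeff_X, coeff_C, coeff_one]

/-- `Tr(ζ′sθ^7) = 0` for `ζ′ = ξ = ζ⁵/Φ₃₆′(ζ)`, `s = √−3 = 1 + 2ζ¹²`, `θ = ζ + ζ⁻¹` (Euler evaluation). research route conditional on HC_CM; not a corollary; Q11.4-sentence-2 already refuted in dim ≥ 3. [folklore] -/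
theorem trace_xi_sqrtNegThree_seven [IsCyclotomicExtension {36} ℚ K] (hζ : IsPrimitiveRoot ζ 36) :
    Algebra.trace ℚ K ((ζ ^ 5 * (aeval ζ (derivative (cyclotomic 36 ℚ)))⁻¹) * (1 + 2 * ζ ^ 12) * (ζ + ζ⁻¹) ^ 7) = 0 := by
  have hΦ := cyc_thirtySix hζ
  rw [trace_of_key hζ (C (-78 : ℚ) + C (0 : ℚ) * X + C (-63 : ℚ) * X ^ 2 + C (0 : ℚ) * X ^ 3 + C (-48 : ℚ) * X ^ 4 +
      C (0 : ℚ) * X ^ 5 + C (48 : ℚ) * X ^ 6 + C (0 : ℚ) * X ^ 7 + C (63 : ℚ) * X ^ 8 + C (0 : ℚ) * X ^ 9 +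
      C (78 : ℚ) * X ^ 10 + C (0 : ℚ) * X ^ 11) (by compute_degree) (by
    simp only [map_add, map_mul, map_pow, aeval_C, aeval_X, eq_ratCast]
    push_cast
    linear_combination ((aeval ζ (derivative (cyclotomic 36 ℚ)))⁻¹ * (ζ^5 + 85 * ζ^7 + 84 * ζ^9 + 84 * ζ^11 + 72 * ζ^13 + 42 * ζ^15 +
        14 * ζ^17 + 2 * ζ^19)) * hΦ)]
  norm_num [coeff_X_pow, coeff_X, coeff_C, coeff_one]

/-- `Tr(ζ′sθ^8) = 156` for `ζ′ = ξ = ζ⁵/Φ₃₆′(ζ)`, `s = √−3 = 1 + 2ζ¹²`, `θ = ζ + ζ⁻¹` (Euler evaluation). research route conditional on HC_CM; not a corollary; Q11.4-sentence-2 already refuted in dim ≥ 3. [folklore] -/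
theorem trace_xi_sqrtNegThree_eight [IsCyclotomicExtension {36} ℚ K] (hζ : IsPrimitiveRoot ζ 36) :
    Algebra.trace ℚ K ((ζ ^ 5 * (aeval ζ (derivative (cyclotomic 36 ℚ)))⁻¹) * (1 + 2 * ζ ^ 12) * (ζ + ζ⁻¹) ^ 8) = 156 := by
  have hΦ := cyc_thirtySix hζ
  rw [trace_of_key hζ (C (0 : ℚ) + C (-141 : ℚ) * X + C (0 : ℚ) * X ^ 2 + C (-111 : ℚ) * X ^ 3 + C (0 : ℚ) * X ^ 4 +
      C (-78 : ℚ) * X ^ 5 + C (0 : ℚ) * X ^ 6 + C (111 : ℚ) * X ^ 7 + C (0 : ℚ) * X ^ 8 + C (141 : ℚ) * X ^ 9 +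
      C (0 : ℚ) * X ^ 10 + C (156 : ℚ) * X ^ 11) (by compute_degree) (by
    simp only [map_add, map_mul, map_pow, aeval_C, aeval_X, eq_ratCast]
    push_cast
    linear_combination ((aeval ζ (derivative (cyclotomic 36 ℚ)))⁻¹ * (ζ^5 + 8 * ζ^7 + 169 * ζ^9 + 168 * ζ^11 + 156 * ζ^13 + 114 * ζ^15 +
        56 * ζ^17 + 16 * ζ^19 + 2 * ζ^21)) * hΦ)]
  norm_num [coeff_X_pow, coeff_X, coeff_C, coeff_one]

/-- `Tr(ζ′sθ^9) = 0` for `ζ′ = ξ = ζ⁵/Φ₃₆′(ζ)`, `s = √−3 = 1 + 2ζ¹²`, `θ = ζ + ζ⁻¹` (Euler evaluation). research route conditional on HC_CM; not a corollary; Q11.4-sentence-2 already refuted in dim ≥ 3. [folklore] -/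
theorem trace_xi_sqrtNegThree_nine [IsCyclotomicExtension {36} ℚ K] (hζ : IsPrimitiveRoot ζ 36) :
    Algebra.trace ℚ K ((ζ ^ 5 * (aeval ζ (derivative (cyclotomic 36 ℚ)))⁻¹) * (1 + 2 * ζ ^ 12) * (ζ + ζ⁻¹) ^ 9) = 0 := by
  have hΦ := cyc_thirtySix hζ
  rw [trace_of_key hζ (C (-297 : ℚ) + C (0 : ℚ) * X + C (-252 : ℚ) * X ^ 2 + C (0 : ℚ) * X ^ 3 + C (-189 : ℚ) * X ^ 4 +
      C (0 : ℚ) * X ^ 5 + C (189 : ℚ) * X ^ 6 + C (0 : ℚ) * X ^ 7 + C (252 : ℚ) * X ^ 8 + C (0 : ℚ) * X ^ 9 +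
      C (297 : ℚ) * X ^ 10 + C (0 : ℚ) * X ^ 11) (by compute_degree) (by
    simp only [map_add, map_mul, map_pow, aeval_C, aeval_X, eq_ratCast]
    push_cast
    linear_combination ((aeval ζ (derivative (cyclotomic 36 ℚ)))⁻¹ * (ζ^5 + 9 * ζ^7 + 333 * ζ^9 + 337 * ζ^11 + 324 * ζ^13 + 270 * ζ^15 +
        170 * ζ^17 + 72 * ζ^19 + 18 * ζ^21 + 2 * ζ^23)) * hΦ)]
  norm_num [coeff_X_pow, coeff_X, coeff_C, coeff_one]

/-- `Tr(ζ′sθ^10) = 594` for `ζ′ = ξ = ζ⁵/Φ₃₆′(ζ)`, `s = √−3 = 1 + 2ζ¹²`, `θ = ζ + ζ⁻¹` (Euler evaluation). research route conditional on HC_CM; not a corollary; Q11.4-sentence-2 already refuted in dim ≥ 3. [folklore] -/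
theorem trace_xi_sqrtNegThree_ten [IsCyclotomicExtension {36} ℚ K] (hζ : IsPrimitiveRoot ζ 36) :
    Algebra.trace ℚ K ((ζ ^ 5 * (aeval ζ (derivative (cyclotomic 36 ℚ)))⁻¹) * (1 + 2 * ζ ^ 12) * (ζ + ζ⁻¹) ^ 10) = 594 := by
  have h36 : ζ ^ 36 = 1 := hζ.pow_eq_one
  have hΦ := cyc_thirtySix hζ
  rw [trace_of_key hζ (C (0 : ℚ) + C (-549 : ℚ) * X + C (0 : ℚ) * X ^ 2 + C (-441 : ℚ) * X ^ 3 + C (0 : ℚ) * X ^ 4 +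
      C (-297 : ℚ) * X ^ 5 + C (0 : ℚ) * X ^ 6 + C (441 : ℚ) * X ^ 7 + C (0 : ℚ) * X ^ 8 + C (549 : ℚ) * X ^ 9 +
      C (0 : ℚ) * X ^ 10 + C (594 : ℚ) * X ^ 11) (by compute_degree) (by
    simp only [map_add, map_mul, map_pow, aeval_C, aeval_X, eq_ratCast]
    push_cast
    linear_combination ((aeval ζ (derivative (cyclotomic 36 ℚ)))⁻¹ * (2 * ζ + ζ^5 + 12 * ζ^7 + 45 * ζ^9 + 670 * ζ^11 + 661 * ζ^13 + 594 * ζ^15 +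
        440 * ζ^17 + 240 * ζ^19 + 90 * ζ^21 + 20 * ζ^23)) * hΦ +
      ((aeval ζ (derivative (cyclotomic 36 ℚ)))⁻¹ * (2 * ζ)) * h36)]
  norm_num [coeff_X_pow, coeff_X, coeff_C, coeff_one]

/-- **The Gram datum `a` of `(E_ζ′, s)` in the real frame `θ^i` (`i < 6`)** for `ζ′ = ξ = ζ⁵/Φ₃₆′(ζ)` (principal type (1)),
`s = √−3 = 1 + 2ζ¹²`: the integer Hankel matrix `(−Tr(ζ′sθ^{i+j}))ᵢⱼ` (and `b = 0`, part 82 `hb_eq_zero`).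
research route conditional on HC_CM; not a corollary; Q11.4-sentence-2 already refuted in dim ≥ 3. [cite: vanGeemen1994HodgeAV, Lemma 5.2 (2)–(3)] -/
theorem realPart_xi_sqrtNegThree [IsCyclotomicExtension {36} ℚ K] [IsCMField K] (hζ : IsPrimitiveRoot ζ 36)
    {x : Fin 6 → K} (hx : ∀ i, x i = (ζ + ζ⁻¹) ^ (i : ℕ)) {a : Matrix (Fin 6) (Fin 6) ℚ}
    (ha : ∀ i j, a i j = Algebra.trace ℚ K ((ζ ^ 5 * (aeval ζ (derivative (cyclotomic 36 ℚ)))⁻¹) * x i * IsCMField.complexConj K ((1 + 2 * ζ ^ 12) * x j))) :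
    a = !![-2, 0, -4, 0, -12, 0; 0, -4, 0, -12, 0, -42; -4, 0, -12, 0, -42, 0; 0, -12, 0, -42, 0, -156; -12, 0, -42, 0, -156, 0; 0, -42, 0, -156, 0, -594] := by
  rw [ha_eq (complexConj_sqrtNegThree hζ) (complexConj_thetaFrame hζ hx) ha]
  ext i j
  simp only [Matrix.of_apply, hx, ← pow_add]
  fin_cases i <;> fin_cases j <;> simp [trace_xi_sqrtNegThree_zero hζ, trace_xi_sqrtNegThree_one hζ, trace_xi_sqrtNegThree_two hζ, trace_xi_sqrtNegThree_three hζ, trace_xi_sqrtNegThree_four hζ, trace_xi_sqrtNegThree_five hζ,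
    trace_xi_sqrtNegThree_six hζ, trace_xi_sqrtNegThree_seven hζ, trace_xi_sqrtNegThree_eight hζ, trace_xi_sqrtNegThree_nine hζ, trace_xi_sqrtNegThree_ten hζ]

/-- **`det a = 1728`** for `ζ′ = ξ = ζ⁵/Φ₃₆′(ζ)`, `s = √−3 = 1 + 2ζ¹²` (frame `θ^i`, `i < 6`). research route conditional on HC_CM; not a corollary; Q11.4-sentence-2 already refuted in dim ≥ 3. [cite: vanGeemen1994HodgeAV, Lemma 5.2 (3)] -/
theorem det_realPart_xi_sqrtNegThree [IsCyclotomicExtension {36} ℚ K] [IsCMField K] (hζ : IsPrimitiveRoot ζ 36)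
    {x : Fin 6 → K} (hx : ∀ i, x i = (ζ + ζ⁻¹) ^ (i : ℕ)) {a : Matrix (Fin 6) (Fin 6) ℚ}
    (ha : ∀ i j, a i j = Algebra.trace ℚ K ((ζ ^ 5 * (aeval ζ (derivative (cyclotomic 36 ℚ)))⁻¹) * x i * IsCMField.complexConj K ((1 + 2 * ζ ^ 12) * x j))) :
    a.det = 1728 := by
  rw [realPart_xi_sqrtNegThree hζ hx ha]
  simp [Matrix.det_succ_row_zero, Fin.sum_univ_succ, Fin.succAbove, Matrix.submatrix]
  norm_num

/-! ### §2 Invariance; §3 the NO row `(36, ℚ(√−3))` from the sign of `det H` -/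

/-- **For EVERY skew `ζ′` of PRINCIPAL type on `ℤ[ζ_36]` (`IsOfType 1 ζ′ ⊤`; `ζ′ = uξ`, `u` a real unit, `N(u) = 1`
by THEOREM L (i) at `36`) the Gram determinant of `(E_ζ′, s₃)` in the frame `θ^i` is `1728`** (such `ζ′` exist for SOME `Φ`, but — below — for no `ℚ(√−3)`-Weil-type `Φ`): the census NO row `(36, ℚ(√−3))`;
`(−1)³ det a < 0`: the WRONG sign for Weil signature `(3,3)` [vG94 5.2 (4)] — see the NO-row theorem below.
research route conditional on HC_CM; not a corollary; Q11.4-sentence-2 already refuted in dim ≥ 3. [cite: vanGeemen1994HodgeAV, Lemma 5.2 (3)–(4) and (5.4.1)] [cite: Shimura1998, §14.3 Prop. 5, p. 104] -/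
theorem det_realPart_principal_sqrtNegThree [IsCyclotomicExtension {36} ℚ K] [IsCMField K]
    (hζ : IsPrimitiveRoot ζ 36) {ζ' : K} (hζ' : IsCMField.complexConj K ζ' = -ζ')
    (hT : CMTypeLattice.IsOfType (1 : (FractionalIdeal (𝓞 K)⁰ K)ˣ) ζ' ⊤)
    {x : Fin 6 → K} (hx : ∀ i, x i = (ζ + ζ⁻¹) ^ (i : ℕ)) {a : Matrix (Fin 6) (Fin 6) ℚ}
    (ha : ∀ i j, a i j = Algebra.trace ℚ K (ζ' * x i * IsCMField.complexConj K ((1 + 2 * ζ ^ 12) * x j))) :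
    a.det = 1728 := by
  obtain ⟨ωb, hωb⟩ := exists_basis_thetaPow hζ
  have hx' : ∀ i, x i = (ωb i : K) := fun i => (hx i).trans (hωb i).symm
  rw [det_realPart_eq_of_isOfType ωb (complexConj_sqrtNegThree hζ) hx' (norm_realUnits_pos_thirtySix hζ)
    (complexConj_xi_thirtySix hζ) (xi_ne_zero hζ 5) hζ' (isOfType_one_xi_top hζ 5) hT (fun i j => rfl) ha]
  exact det_realPart_xi_sqrtNegThree hζ hx (fun i j => rfl)

open scoped Classical in
/-- **NO principal-type `E_ζ′` on `ℤ[ζ_36]` is `Φ`-positive on a `ℚ(√−3)`-signature-`(3,3)` CM type** (`s = √−3 = 1 + 2ζ¹²`):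
`det a = 1728 > 0` for every skew principal-type `ζ′` (above), while van Geemen's sign would force `0 < (−1)³ det a`
(part 92 `not_pos_of_neg_one_pow_mul_det_nonpos`) — the census NO row `(36, ℚ(√−3))` (b01.34, THEOREM L there via
unit signatures) RE-DERIVED from a determinant sign.
research route conditional on HC_CM; not a corollary; Q11.4-sentence-2 already refuted in dim ≥ 3. [cite: vanGeemen1994HodgeAV, Lemma 5.2 (4)] [cite: Shimura1998, §14.3 Prop. 4–5, pp. 103–104] -/
theorem not_pos_of_principal_sqrtNegThree [IsCyclotomicExtension {36} ℚ K] [IsCMField K] (hζ : IsPrimitiveRoot ζ 36)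
    (Φ : CMType K)
    (hneg : (Finset.univ.filter fun φ : Φ.1 => (φ.1 (1 + 2 * ζ ^ 12)).im < 0).card = 3)
    (hposc : (Finset.univ.filter fun φ : Φ.1 => 0 < (φ.1 (1 + 2 * ζ ^ 12)).im).card = 3)
    {ζ' : K} (hζ' : IsCMField.complexConj K ζ' = -ζ')
    (hT : CMTypeLattice.IsOfType (1 : (FractionalIdeal (𝓞 K)⁰ K)ˣ) ζ' ⊤) :
    ¬ ∀ φ : Φ.1, 0 < (φ.1 ζ').im := by
  obtain ⟨ωb, hωb⟩ := exists_basis_thetaPow hζ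
  have hs := complexConj_sqrtNegThree hζ
  have hs0 : ((1 + 2 * ζ ^ 12) : K) ≠ 0 := fun h => by
    have h2 := sq_sqrtNegThree hζ
    rw [h] at h2
    norm_num at h2
  obtain ⟨γ₀, hγ⟩ := exists_real_eq_mul_of_skew hζ' hs
  set A : Matrix (Fin 6) (Fin 6) ℚ := Matrix.of fun i j => Algebra.trace ℚ K (ζ' * (ωb i : K) *
      IsCMField.complexConj K ((1 + 2 * ζ ^ 12) * (ωb j : K))) with hA
  have hA' : ∀ i j, A i j = Algebra.trace ℚ K (ζ' * (ωb i : K) *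
      IsCMField.complexConj K ((1 + 2 * ζ ^ 12) * (ωb j : K))) := fun i j => rfl
  have hdet := det_realPart_principal_sqrtNegThree hζ hζ' hT (x := fun i => (ωb i : K)) hωb hA'
  have hζ'0 : ζ' ≠ 0 := by
    intro h0
    have hzero : A = 0 := by
      ext i j
      simp [hA, h0]
    rw [hzero, Matrix.det_zero] at hdet
    norm_num at hdet
  exact not_pos_of_neg_one_pow_mul_det_nonpos Φ ωb hζ' hs hs0 hζ'0 hneg hposc (fun i => rfl) hγ hA'
    (by rw [hdet]; norm_num)

end Summit.HodgeConjecture.Ring2WeilCoverage.WeilGramLevel36SqrtNegThree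

end
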